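import Summits.Ventures.YMGap.Thresholds.ZeroCouplingResampling
import Summits.Ventures.YMGap.Thresholds.HaarThirdMomentSU3Trace
import HarnessLib

/-!
# `SU(3)` plaquette moments of order `≤ 3` under the infinite Haar product `dg_∞` (THE DLR state at `β = 0`): the third
# moments are `δ_{a=b=c}/108` — the connected three-point function of `SU(3)` does NOT vanish at `β = 0`
# (row type C-PRESS, endpoint `β = 0`, part 15)

Cell `pub-ymgap`, seat ds-1 (gen 11). HONEST FRAMING: exact strong-coupling LATTICE statements AT `β = 0` for `SU(3)` Wilson lattice
gauge theory on `ℤ^d` (any `d`): moments of the plaquette variables `W_p = (1/3) Re tr U_p` under the product Haar measure `zdHaar d G`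
for a compact group `G ≅ SU(3)`; nothing about `β > 0`, nothing about the continuum or the Clay problem. Kernel theorems only,
0 compute, no definitions.

From part 11a (a plaquette of multiplicity one kills the moment, every `SU(N)`) and part 14b (`∫ ((1/3) Re tr U)³ dU = 1/108`,
the baryon/determinant vertex of `SU(3)`): ★★ `su3_integral_mul₂_zdHaar`: `∫ W_a W_b W_c dg_∞ = δ_{a=b=c}/108`; with `∫ W_a = 0` and
`∫ W_a W_b = δ_{ab}/18` (`su3_integral_mul_zdHaar`, `V₀(SU(3)) = 1/2`) this is the full third cumulant: ★★ `su3_threePoint_zdHaar`: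
`u₃(W_a; W_b; W_c)|_{dg_∞} = δ_{a=b=c}/108` in the tree's spelled-out form — in CONTRAST with EVERY OTHER `SU(N)`: for `N ≥ 2`,
`N ≠ 3` all third plaquette moments and `u₃` vanish at `β = 0` (`integral_mul₂_zdHaar_of_ne_three`, `threePoint_zdHaar_of_ne_three`, from
part 14b's centre-twist lemma; `N = 2` is also part 11b's `su2_threePoint_zdHaar`). Consequence for the strong-coupling series (to be drawn with the `SU(N)` C²
chain `CouplingSecondDerivativeSUN`): the second `β`-derivative of the `SU(3)` mean plaquette at `β = 0⁺` is the diagonal third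
cumulant, NOT zero. References: Balian–Drouffe–Itzykson, Phys. Rev. D 11 (1975) 2104 §III; M. Creutz, *Quarks, gluons and lattices*
(1983) §8, §10. Everything here is proved. [folklore]
-/

noncomputable section

open MeasureTheory ProbabilityTheory Finset
open Literature.MathematicalPhysics.QuantumLattice (ZdPlaquette plaquetteEdges fundamentalRep plaquetteObs)
open Literature.MathematicalPhysics.QuantumFieldTheory hiding ZdEdge
open Literature.Probability.LatticeModels (Site)

namespace Summit.Ventures.YMGap.ZeroCouplingMoments

section SU3

open Literature.MathematicalPhysics.QuantumFieldTheory.PlaquetteLowerBound (reTr charVariance)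

variable {d : ℕ} {G : Type*} [Group G] [TopologicalSpace G] [IsTopologicalGroup G] [CompactSpace G]
  [MeasurableSpace G] [BorelSpace G] [SecondCountableTopology G] {ρ : G →* Matrix (Fin 3) (Fin 3) ℂ}

/-- Shorthand for this section: the `SU(3)` plaquette variable `W_p = (1/3) Re tr U_p` on `ℤ^d`. -/
local notation3 (prettyPrint := false) "𝔚" => fun (p : ZdPlaquette d) (U : ZdGaugeConfig d G) =>
  zdPlaquetteObs ρ p.1 p.2.1.1 p.2.1.2 U

/-- Local shorthand: the connected three-point function `u₃(X; Y; Z)` under `μ` (the tree's spelled-out form). -/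
local notation3 (prettyPrint := false) "U₃[" X ";" Y ";" Z ";" μ "]" =>
  cov[fun ω => X ω * Y ω, Z; μ] - (∫ ω, X ω ∂μ) * cov[Y, Z; μ] - (∫ ω, Y ω ∂μ) * cov[X, Z; μ]

/-- `SU(3)`: `∫ W_p W_p W_p dg_∞ = 1/108` (the plaquette matrix is Haar distributed; part 14b). [folklore] -/
theorem su3_integral_cube_zdHaar (hρ : IsSpecialUnitaryModel ρ) (p : ZdPlaquette d) :
    ∫ U, 𝔚 p U * 𝔚 p U * 𝔚 p U ∂zdHaar d G = 1 / 108 := by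
  have h := integral_pow_three_zdHaar (d := d) (G := G) hρ.1 p
  simp only [Nat.cast_ofNat] at h
  rw [HaarThirdMomentSU3.integral_third_reTr_pow_three ρ hρ] at h
  exact (integral_congr_ae (Filter.Eventually.of_forall fun U => by ring)).trans h

/-- `SU(3)`: `∫ W_p W_q dg_∞ = δ_{pq}/18` (`V₀(SU(3)) = 1/2`). [folklore] -/
theorem su3_integral_mul_zdHaar (hρ : IsSpecialUnitaryModel ρ) (p q : ZdPlaquette d) :
    ∫ U, 𝔚 p U * 𝔚 q U ∂zdHaar d G = if p = q then 1 / 18 else 0 := by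
  show ∫ U, zdPlaquetteObs ρ p.1 p.2.1.1 p.2.1.2 U * zdPlaquetteObs ρ q.1 q.2.1.1 q.2.1.2 U ∂zdHaar d G = _
  rw [integral_mul_zdHaar hρ (by norm_num), RobustBall.HaarSecondMoments.charVariance_eq_half ρ hρ le_rfl]
  norm_num

/-- ★★ **`SU(3)`: THE THIRD PLAQUETTE MOMENTS AT `β = 0`**: `∫ W_a W_b W_c dg_∞ = δ_{a=b=c}/108` — zero unless all three
plaquettes coincide (a plaquette of multiplicity one kills the moment), and `E W³ = (1/27)·(1/4)` on the diagonal (the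
`SU(3)` baryon/determinant vertex). [folklore] -/
theorem su3_integral_mul₂_zdHaar (hρ : IsSpecialUnitaryModel ρ) (a b c : ZdPlaquette d) :
    ∫ U, 𝔚 a U * 𝔚 b U * 𝔚 c U ∂zdHaar d G = if a = b ∧ b = c then 1 / 108 else 0 := by
  -- a plaquette occurring exactly once in a third moment kills it (positions 1, 2, 3; gen 11's `integral_mul₂_eq_zero_of_ne`)
  have su3_integral_third_single_zdHaar : ∀ {s p q : ZdPlaquette d}, s ≠ p → s ≠ q →
      ∫ U, 𝔚 s U * 𝔚 p U * 𝔚 q U ∂zdHaar d G = 0 ∧ ∫ U, 𝔚 p U * 𝔚 s U * 𝔚 q U ∂zdHaar d G = 0 ∧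
        ∫ U, 𝔚 p U * 𝔚 q U * 𝔚 s U ∂zdHaar d G = 0 := fun hp hq => by
    have h := integral_mul₂_eq_zero_of_ne (d := d) (G := G) hρ (by norm_num) hp hq
    exact ⟨(integral_congr_ae (Filter.Eventually.of_forall fun U => by ring)).trans h,
      (integral_congr_ae (Filter.Eventually.of_forall fun U => by ring)).trans h,
      (integral_congr_ae (Filter.Eventually.of_forall fun U => by ring)).trans h⟩
  by_cases hab : a = b
  · subst hab
    by_cases hac : a = c
    · subst hac
      rw [if_pos ⟨rfl, rfl⟩]
      exact su3_integral_cube_zdHaar hρ a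
    · rw [if_neg fun h => hac h.2, (su3_integral_third_single_zdHaar (Ne.symm hac) (Ne.symm hac)).2.2]
  · rw [if_neg fun h => hab h.1]
    by_cases hac : a = c
    · subst hac
      exact (su3_integral_third_single_zdHaar (Ne.symm hab) (Ne.symm hab)).2.1
    · exact (su3_integral_third_single_zdHaar hab hac).1

omit [CompactSpace G] in
/-- Measurability and the bound `|W_p| ≤ 1` of the `SU(3)` plaquette variables and their pair products. [folklore] -/
theorem su3_zdPlaquetteObs_data (hρ : IsSpecialUnitaryModel ρ) (a b : ZdPlaquette d) :
    (Measurable (𝔚 a) ∧ ∀ U, |𝔚 a U| ≤ 1) ∧ (Measurable (fun U => 𝔚 a U * 𝔚 b U) ∧ ∀ U, |𝔚 a U * 𝔚 b U| ≤ 1) := by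
  have hm : ∀ r : ZdPlaquette d, Measurable (𝔚 r) := fun r => (continuous_zdPlaquetteObs (d := d) hρ.1 r).measurable
  have hb : ∀ (r : ZdPlaquette d) (U : ZdGaugeConfig d G), |𝔚 r U| ≤ 1 := fun r U =>
    abs_zdPlaquetteObs_le (IsSpecialUnitaryModel.mem_unitaryGroup ρ hρ) _ _ _ U
  refine ⟨⟨hm a, hb a⟩, ⟨(hm a).mul (hm b), fun U => ?_⟩⟩
  rw [abs_mul]
  calc |𝔚 a U| * |𝔚 b U| ≤ 1 * 1 := mul_le_mul (hb a U) (hb b U) (abs_nonneg _) zero_le_one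
    _ = 1 := one_mul 1

/-- ★★ **`SU(3)`, every `d`: the connected three-point function of plaquette variables at `β = 0` is the diagonal third
cumulant**, `u₃(W_a; W_b; W_c)|_{dg_∞} = δ_{a=b=c}/108 ≠ 0` on the diagonal — contrast `SU(2)` (`su2_threePoint_zdHaar`: `≡ 0`).
[folklore] -/
theorem su3_threePoint_zdHaar (hρ : IsSpecialUnitaryModel ρ) (a b c : ZdPlaquette d) :
    U₃[𝔚 a ; 𝔚 b ; 𝔚 c ; zdHaar d G] = if a = b ∧ b = c then 1 / 108 else 0 := by
  obtain ⟨⟨hma, hba⟩, ⟨hmab, hbab⟩⟩ := su3_zdPlaquetteObs_data (d := d) (G := G) hρ a b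
  obtain ⟨⟨hmc, hbc⟩, -⟩ := su3_zdPlaquetteObs_data (d := d) (G := G) hρ c a
  have h0 : ∀ r : ZdPlaquette d, ∫ U, 𝔚 r U ∂zdHaar d G = 0 := fun r =>
    PressureRegularity.integral_zdPlaquetteObs_zdHaar hρ (by norm_num) r
  rw [CouplingResponse.covariance_eq_sub_of_abs_le hmab hmc hbab hbc, h0 a, h0 b, h0 c, su3_integral_mul₂_zdHaar hρ a b c]
  ring

end SU3

/-! ## Every `SU(N)` with `N ≥ 2`, `N ≠ 3`: ALL third plaquette moments and `u₃` vanish at `β = 0` (centre twist) -/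

section GeneralN

open Literature.MathematicalPhysics.QuantumFieldTheory.PlaquetteLowerBound (reTr charVariance)

variable {d N : ℕ} {G : Type*} [Group G] [TopologicalSpace G] [IsTopologicalGroup G] [CompactSpace G]
  [MeasurableSpace G] [BorelSpace G] [SecondCountableTopology G] {ρ : G →* Matrix (Fin N) (Fin N) ℂ}

/-- Shorthand for this section: the `SU(N)` plaquette variable `W_p = (1/N) Re tr U_p` on `ℤ^d`. -/
local notation3 (prettyPrint := false) "𝔚" => fun (p : ZdPlaquette d) (U : ZdGaugeConfig d G) =>
  zdPlaquetteObs ρ p.1 p.2.1.1 p.2.1.2 U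

/-- Local shorthand: the connected three-point function `u₃(X; Y; Z)` under `μ` (the tree's spelled-out form). -/
local notation3 (prettyPrint := false) "U₃[" X ";" Y ";" Z ";" μ "]" =>
  cov[fun ω => X ω * Y ω, Z; μ] - (∫ ω, X ω ∂μ) * cov[Y, Z; μ] - (∫ ω, Y ω ∂μ) * cov[X, Z; μ]

/-- `SU(N)`, `N ≥ 2`, `N ≠ 3`: `∫ W_p W_p W_p dg_∞ = 0` (part 14b: the third character moment vanishes by the centre twist). [folklore] -/
theorem integral_cube_zdHaar_of_ne_three (hρ : IsSpecialUnitaryModel ρ) (hN : 2 ≤ N) (hN3 : N ≠ 3) (p : ZdPlaquette d) :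
    ∫ U, 𝔚 p U * 𝔚 p U * 𝔚 p U ∂zdHaar d G = 0 := by
  have h := integral_pow_three_zdHaar (d := d) (G := G) hρ.1 p
  simp_rw [mul_pow] at h
  rw [integral_const_mul, HaarThirdMomentSU3.integral_reTr_pow_three_eq_zero ρ hρ hN hN3, mul_zero] at h
  exact (integral_congr_ae (Filter.Eventually.of_forall fun U => by ring)).trans h

/-- ★ **Every `SU(N)` with `N ≥ 2`, `N ≠ 3`: ALL third plaquette moments vanish at `β = 0`**, `∫ W_a W_b W_c dg_∞ = 0` (a plaquette of
multiplicity one kills the moment; the diagonal is the third character moment, zero unless `N = 3`). [folklore] -/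
theorem integral_mul₂_zdHaar_of_ne_three (hρ : IsSpecialUnitaryModel ρ) (hN : 2 ≤ N) (hN3 : N ≠ 3) (a b c : ZdPlaquette d) :
    ∫ U, 𝔚 a U * 𝔚 b U * 𝔚 c U ∂zdHaar d G = 0 := by
  have single : ∀ {s p q : ZdPlaquette d}, s ≠ p → s ≠ q →
      ∫ U, 𝔚 s U * 𝔚 p U * 𝔚 q U ∂zdHaar d G = 0 ∧ ∫ U, 𝔚 p U * 𝔚 s U * 𝔚 q U ∂zdHaar d G = 0 ∧
        ∫ U, 𝔚 p U * 𝔚 q U * 𝔚 s U ∂zdHaar d G = 0 := by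
    intro s p q hp hq
    have h := integral_mul₂_eq_zero_of_ne (d := d) (G := G) hρ hN hp hq
    exact ⟨(integral_congr_ae (Filter.Eventually.of_forall fun U => by ring)).trans h,
      (integral_congr_ae (Filter.Eventually.of_forall fun U => by ring)).trans h,
      (integral_congr_ae (Filter.Eventually.of_forall fun U => by ring)).trans h⟩
  by_cases hab : a = b
  · subst hab
    by_cases hac : a = c
    · subst hac
      exact integral_cube_zdHaar_of_ne_three hρ hN hN3 a
    · exact (single (Ne.symm hac) (Ne.symm hac)).2.2
  · by_cases hac : a = c
    · subst hac
      exact (single (Ne.symm hab) (Ne.symm hab)).2.1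
    · exact (single hab hac).1

omit [CompactSpace G] in
/-- Measurability and the bound `|W_p| ≤ 1` of the `SU(N)` plaquette variables and their pair products. [folklore] -/
theorem zdPlaquetteObs_data_SU (hρ : IsSpecialUnitaryModel ρ) (a b : ZdPlaquette d) :
    (Measurable (𝔚 a) ∧ ∀ U, |𝔚 a U| ≤ 1) ∧ (Measurable (fun U => 𝔚 a U * 𝔚 b U) ∧ ∀ U, |𝔚 a U * 𝔚 b U| ≤ 1) := by
  have hm : ∀ r : ZdPlaquette d, Measurable (𝔚 r) := fun r => (continuous_zdPlaquetteObs (d := d) hρ.1 r).measurable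
  have hb : ∀ (r : ZdPlaquette d) (U : ZdGaugeConfig d G), |𝔚 r U| ≤ 1 := fun r U =>
    abs_zdPlaquetteObs_le (IsSpecialUnitaryModel.mem_unitaryGroup ρ hρ) _ _ _ U
  refine ⟨⟨hm a, hb a⟩, ⟨(hm a).mul (hm b), fun U => ?_⟩⟩
  rw [abs_mul]
  calc |𝔚 a U| * |𝔚 b U| ≤ 1 * 1 := mul_le_mul (hb a U) (hb b U) (abs_nonneg _) zero_le_one
    _ = 1 := one_mul 1

/-- ★★ **Every `SU(N)` with `N ≥ 2`, `N ≠ 3`, every `d`: the connected three-point function of plaquette variables VANISHES at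
`β = 0`**, `u₃(W_a; W_b; W_c)|_{dg_∞} = 0` — only `SU(3)` has a cubic vertex at `β = 0` (`su3_threePoint_zdHaar`: `δ_{a=b=c}/108`).
[folklore] -/
theorem threePoint_zdHaar_of_ne_three (hρ : IsSpecialUnitaryModel ρ) (hN : 2 ≤ N) (hN3 : N ≠ 3) (a b c : ZdPlaquette d) :
    U₃[𝔚 a ; 𝔚 b ; 𝔚 c ; zdHaar d G] = 0 := by
  obtain ⟨⟨hma, hba⟩, ⟨hmab, hbab⟩⟩ := zdPlaquetteObs_data_SU (d := d) (G := G) hρ a b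
  obtain ⟨⟨hmc, hbc⟩, -⟩ := zdPlaquetteObs_data_SU (d := d) (G := G) hρ c a
  have h0 : ∀ r : ZdPlaquette d, ∫ U, 𝔚 r U ∂zdHaar d G = 0 := fun r =>
    PressureRegularity.integral_zdPlaquetteObs_zdHaar hρ hN r
  rw [CouplingResponse.covariance_eq_sub_of_abs_le hmab hmc hbab hbc, h0 a, h0 b, h0 c,
    integral_mul₂_zdHaar_of_ne_three hρ hN hN3 a b c]
  ring

end GeneralN

/-! ## The concrete group `SU(3) = Matrix.specialUnitaryGroup (Fin 3) ℂ` -/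

section Concrete3

open Literature.MathematicalPhysics.QuantumFieldTheory.TorusAreaLaw (isSpecialUnitaryModel_fundamentalRep)

/-- `SU(3)` is second countable (closed subgroup of `3 × 3` complex matrices). [folklore] -/
private theorem secondCountable_su3 : SecondCountableTopology (Matrix.specialUnitaryGroup (Fin 3) ℂ) :=
  haveI : SecondCountableTopology (Matrix (Fin 3) (Fin 3) ℂ) :=
    inferInstanceAs (SecondCountableTopology (Fin 3 → Fin 3 → ℂ))
  Topology.IsEmbedding.subtypeVal.secondCountableTopology

variable {d : ℕ}

/-- ★★ **`SU(3)` on `ℤ^d`, `β = 0`: the third plaquette moments are `δ_{a=b=c}/108`** (venture vocabulary `fundamentalRep (Fin 3)`).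
[folklore] -/
theorem su3_integral_mul₂_zdHaar_fundamental (a b c : ZdPlaquette d) :
    ∫ U, zdPlaquetteObs (fundamentalRep (Fin 3)) a.1 a.2.1.1 a.2.1.2 U *
        zdPlaquetteObs (fundamentalRep (Fin 3)) b.1 b.2.1.1 b.2.1.2 U *
        zdPlaquetteObs (fundamentalRep (Fin 3)) c.1 c.2.1.1 c.2.1.2 U ∂zdHaar d (Matrix.specialUnitaryGroup (Fin 3) ℂ) =
      if a = b ∧ b = c then 1 / 108 else 0 := by
  haveI := secondCountable_su3
  exact su3_integral_mul₂_zdHaar (isSpecialUnitaryModel_fundamentalRep 3) a b c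

end Concrete3

end Summit.Ventures.YMGap.ZeroCouplingMoments
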